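import Mathlib
import HarnessLib
import Summits.Ventures.LatticeQCDFlow.Exactness.SU3SpectralKernelPolarBoxFlow
import Summits.Ventures.LatticeQCDFlow.Exactness.SpectralRecipeOffWalls
import Summits.Ventures.LatticeQCDFlow.Exactness.KernelCouplingJacobian

/-!
# The `SU(3)` spectral kernel and coupling layer AS SHIPPED with the POLAR cell (`cell='polar'`, v0.3): measurable data, recipe and equivariance only at simple spectra

HONEST FRAMING: exact (Metropolis-corrected) sampling algorithms for lattice gauge theory;
figures of merit are autocorrelation/cost numbers at stated couplings and volumes; no
continuum-physics claim.

Venture `LatticeQCDFlow` (cell pub-lqcd), topic `Exactness`; FANOUT row 10 (`eng-equiv`, engine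
`latflow.equiv` v0.3 `spectral.spectral_kernel(3, cell='polar')` / `SUNSpectralCoupling(cell='polar')`;
Abbott et al. 2305.02402 §4.1.1, named only).  NEW WORK of the cell: the polar-cell twin of
`SU3SpectralKernelShipped` (charts `T` box → wedge, `Q` wedge → alcove of `PolarChartSU3`).
`SU3SpectralKernelPolarBoxFlow.lean` certifies a kernel following the
spectral recipe in EVERY diagonalization with an eigenvalue map equivariant at EVERY unimodular
spectrum; the shipped kernel sorts eigen-phases into the cell, which follows the recipe and is
equivariant only at SIMPLE spectra.  `SpectralRecipeOffWalls.lean` (wall-identity modifications,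
walls Haar-null) makes the difference irrelevant; `KernelCouplingJacobian.hasJacobian_kernelCouplingLayer`
assembles the layer.  Nothing continuous; nothing cited as a fact; no number; no definition.

* **`hasJacobian_spectralKernel_su3_polar_shipped`** — kernel level;
* **`hasJacobian_spectralCouplingLayer_su3_polar_shipped`** — layer level: `coupleFun` of shipped kernels
  read from frozen links, kernel and density jointly measurable in (frozen links, loop), is an exact
  transport of `⊗ Haar_{SU(3)}` with `ofReal ∘ coupleJac p (j at the loops)`.
-/

noncomputable section

namespace Summit.Ventures.LatticeQCDFlow.Exactness

open MeasureTheory Matrix Set Real Finset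
open Literature.LinearAlgebra.Matrix
open Literature.MathematicalPhysics.QuantumFieldTheory (haarProbability)
open scoped ENNReal

section Shipped

variable {T Q : (Fin 2 → ℝ) → (Fin 2 → ℝ)}
  (hT : ∀ a, T a = ![π / 3 * a 0, a 1 * (π / (Real.sqrt 3 * Real.cos (π / 3 * a 0 - π / 6)))])
  (hQ : ∀ z, Q z = ![-2 * z 1 * Real.cos (z 0), z 1 * Real.cos (z 0) - Real.sqrt 3 * z 1 * Real.sin (z 0)])

include hT hQ

/-- **The `SU(3)` spectral kernel as shipped is an exact transport of Haar with the booked density.**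
Box flow `χ` on `B = (0,1)²` with `HasJacobian (Leb|_B) χ Jχ`, `χ(B) ⊆ B`; shipped eigenvalue map `f`
MEASURABLE, permutation-equivariant and unimodularity/unit-product preserving AT INJECTIVE unimodular
spectra, with `f(e^{ix(QTa)}) = e^{ix(QT(χa))}` on `B`; shipped kernel `h` MEASURABLE, following the
spectral recipe of `f` in every unitary diagonalization WITH INJECTIVE SPECTRUM; spectral datum `JD`
measurable, symmetric at injective spectra, with the booked box-coordinate value on `B`
(`JD·|Δ|²/3! = (D(χa)·Jχ(a)/D(a))·|Δ'|²/3!`, `D = |det d(Q∘T)|`); shipped density `J` MEASURABLE with `J W = JD d` in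
every unitary diagonalization with injective `d`.  Then `HasJacobian (Haar SU(3)) h J`. -/
theorem hasJacobian_spectralKernel_su3_polar_shipped
    {f : (Fin 3 → ℂ) → (Fin 3 → ℂ)} (hfm : Measurable f)
    (hfperm : ∀ (σ : Equiv.Perm (Fin 3)) (d : Fin 3 → ℂ), (∀ i, ‖d i‖ = 1) → Function.Injective d →
      f (fun i => d (σ i)) = fun i => f d (σ i))
    {χ : (Fin 2 → ℝ) → (Fin 2 → ℝ)} {Jχ : (Fin 2 → ℝ) → ℝ≥0∞}
    (hχ : HasJacobian (volume.restrict (Set.pi univ fun _ : Fin 2 => Ioo (0 : ℝ) 1)) χ Jχ)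
    (hχbox : ∀ a ∈ Set.pi univ (fun _ : Fin 2 => Ioo (0 : ℝ) 1), χ a ∈ Set.pi univ fun _ : Fin 2 => Ioo (0 : ℝ) 1)
    (hfG : ∀ a ∈ Set.pi univ (fun _ : Fin 2 => Ioo (0 : ℝ) 1),
      f (fun i => (Circle.exp ((![(Q (T a)) 0, (Q (T a)) 1, -((Q (T a)) 0 + (Q (T a)) 1)] : Fin 3 → ℝ) i) : ℂ)) =
        fun i => (Circle.exp ((![(Q (T (χ a))) 0, (Q (T (χ a))) 1,
          -((Q (T (χ a))) 0 + (Q (T (χ a))) 1)] : Fin 3 → ℝ) i) : ℂ))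
    {h : Matrix.specialUnitaryGroup (Fin 3) ℂ → Matrix.specialUnitaryGroup (Fin 3) ℂ} (hhm : Measurable h)
    (hagree : ∀ (Q : Matrix.specialUnitaryGroup (Fin 3) ℂ) (V : Matrix (Fin 3) (Fin 3) ℂ) (d : Fin 3 → ℂ),
      V ∈ Matrix.unitaryGroup (Fin 3) ℂ → Function.Injective d →
        (Q : Matrix (Fin 3) (Fin 3) ℂ) = V * diagonal d * star V →
        ((h Q : Matrix.specialUnitaryGroup (Fin 3) ℂ) : Matrix (Fin 3) (Fin 3) ℂ) = V * diagonal (f d) * star V)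
    (hf1 : ∀ d : Fin 3 → ℂ, (∀ i, ‖d i‖ = 1) → Function.Injective d → ∀ i, ‖f d i‖ = 1)
    (hfdet : ∀ d : Fin 3 → ℂ, (∀ i, ‖d i‖ = 1) → Function.Injective d → ∏ i, d i = 1 → ∏ i, f d i = 1)
    {JD : (Fin 3 → ℂ) → ℝ≥0∞} (hJDm : Measurable JD)
    (hJDperm : ∀ (σ : Equiv.Perm (Fin 3)) (d : Fin 3 → ℂ), Function.Injective d → JD (fun i => d (σ i)) = JD d)
    (hJchart : ∀ a ∈ Set.pi univ (fun _ : Fin 2 => Ioo (0 : ℝ) 1),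
      JD (fun i => (Circle.exp ((![(Q (T a)) 0, (Q (T a)) 1, -((Q (T a)) 0 + (Q (T a)) 1)] : Fin 3 → ℝ) i) : ℂ)) *
          ENNReal.ofReal ((∏ i, ∏ k ∈ Finset.univ.erase i,
            ‖(Circle.exp ((![(Q (T a)) 0, (Q (T a)) 1, -((Q (T a)) 0 + (Q (T a)) 1)] : Fin 3 → ℝ) i) : ℂ) -
              (Circle.exp ((![(Q (T a)) 0, (Q (T a)) 1, -((Q (T a)) 0 + (Q (T a)) 1)] : Fin 3 → ℝ) k) : ℂ)‖) /
                (Fintype.card (Fin 3)).factorial) =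
        (ENNReal.ofReal |(-2 * Real.sqrt 3 * (T (χ a)) 1) * (π / 3 * (π / (Real.sqrt 3 * Real.cos (π / 3 * (χ a) 0 - π / 6))))| *
            Jχ a /
          ENNReal.ofReal |(-2 * Real.sqrt 3 * (T a) 1) * (π / 3 * (π / (Real.sqrt 3 * Real.cos (π / 3 * a 0 - π / 6))))|) *
          ENNReal.ofReal ((∏ i, ∏ k ∈ Finset.univ.erase i,
            ‖(Circle.exp ((![(Q (T (χ a))) 0, (Q (T (χ a))) 1, -((Q (T (χ a))) 0 + (Q (T (χ a))) 1)] : Fin 3 → ℝ) i) : ℂ) -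
              (Circle.exp ((![(Q (T (χ a))) 0, (Q (T (χ a))) 1, -((Q (T (χ a))) 0 + (Q (T (χ a))) 1)] :
                Fin 3 → ℝ) k) : ℂ)‖) / (Fintype.card (Fin 3)).factorial))
    {J : Matrix.specialUnitaryGroup (Fin 3) ℂ → ℝ≥0∞} (hJm : Measurable J)
    (hJspec : ∀ (W : Matrix.specialUnitaryGroup (Fin 3) ℂ) (V : Matrix (Fin 3) (Fin 3) ℂ) (d : Fin 3 → ℂ),
      V ∈ Matrix.unitaryGroup (Fin 3) ℂ → Function.Injective d →
        (W : Matrix (Fin 3) (Fin 3) ℂ) = V * diagonal d * star V → J W = JD d) :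
    HasJacobian (haarProbability (Matrix.specialUnitaryGroup (Fin 3) ℂ)) h J := by
  classical
  obtain ⟨E, -, hE⟩ := exists_angleChart_su3
  -- wall-identity modifications
  obtain ⟨f', hf'm, hf'reg, hf'wall⟩ := exists_wallId_eigenvalueMap hfm
  obtain ⟨h', hh'm, hh'reg, hh'wall⟩ := exists_wallId_kernel hhm
  obtain ⟨JD', hJD'm, hJD'reg, hJD'wall⟩ := exists_wallId_datum hJDm
  have hSep : MeasurableSet {W : Matrix.specialUnitaryGroup (Fin 3) ℂ |
      (W : Matrix (Fin 3) (Fin 3) ℂ).charpoly.Separable} := by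
    have h0 := Literature.MathematicalPhysics.QuantumFieldTheory.Balaban1983to89.HaarRegularElementsNull.measurableSet_specialUnitaryGroup_setOf_not_separable
      (n := Fin 3)
    have heq : {W : Matrix.specialUnitaryGroup (Fin 3) ℂ | (W : Matrix (Fin 3) (Fin 3) ℂ).charpoly.Separable} =
        {W : Matrix.specialUnitaryGroup (Fin 3) ℂ | ¬ (W : Matrix (Fin 3) (Fin 3) ℂ).charpoly.Separable}ᶜ := by
      ext W
      simp
    rw [heq]
    exact h0.compl
  set J' : Matrix.specialUnitaryGroup (Fin 3) ℂ → ℝ≥0∞ := fun W =>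
    if (W : Matrix (Fin 3) (Fin 3) ℂ).charpoly.Separable then J W else 1 with hJ'def
  have hJ'm : Measurable J' := Measurable.ite hSep hJm measurable_const
  have hJ'reg : ∀ W : Matrix.specialUnitaryGroup (Fin 3) ℂ,
      (W : Matrix (Fin 3) (Fin 3) ℂ).charpoly.Separable → J' W = J W := fun W hW => if_pos hW
  have hJ'wall : ∀ W : Matrix.specialUnitaryGroup (Fin 3) ℂ,
      ¬ (W : Matrix (Fin 3) (Fin 3) ℂ).charpoly.Separable → J' W = 1 := fun W hW => if_neg hW
  -- alcove spectra are injective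
  have hinjB : ∀ a ∈ Set.pi univ (fun _ : Fin 2 => Ioo (0 : ℝ) 1),
      Function.Injective fun i : Fin 3 =>
        (Circle.exp ((![(Q (T a)) 0, (Q (T a)) 1, -((Q (T a)) 0 + (Q (T a)) 1)] : Fin 3 → ℝ) i) : ℂ) := by
    intro a ha
    have hA : Q (T a) ∈ {θ : Fin 2 → ℝ | θ 0 < θ 1 ∧ θ 1 < -(θ 0 + θ 1) ∧ -(θ 0 + θ 1) < θ 0 + 2 * π} := by
      rw [← image_polarChart_su3 hT hQ]
      exact ⟨a, ha, rfl⟩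
    obtain ⟨h0, h1, h2⟩ := hA
    intro i j hij
    by_contra hne
    refine angleChart_su3_regular hE h0 h1 h2 i j hne ?_
    rw [hE, hE]
    exact hij
  -- the everywhere hypotheses for the primed data
  have hfG' : ∀ a ∈ Set.pi univ (fun _ : Fin 2 => Ioo (0 : ℝ) 1),
      f' (fun i => (Circle.exp ((![(Q (T a)) 0, (Q (T a)) 1, -((Q (T a)) 0 + (Q (T a)) 1)] : Fin 3 → ℝ) i) : ℂ)) =
        fun i => (Circle.exp ((![(Q (T (χ a))) 0, (Q (T (χ a))) 1,
          -((Q (T (χ a))) 0 + (Q (T (χ a))) 1)] : Fin 3 → ℝ) i) : ℂ) := by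
    intro a ha
    rw [hf'reg _ (hinjB a ha)]
    exact hfG a ha
  have hJchart' : ∀ a ∈ Set.pi univ (fun _ : Fin 2 => Ioo (0 : ℝ) 1),
      JD' (fun i => (Circle.exp ((![(Q (T a)) 0, (Q (T a)) 1, -((Q (T a)) 0 + (Q (T a)) 1)] : Fin 3 → ℝ) i) : ℂ)) *
          ENNReal.ofReal ((∏ i, ∏ k ∈ Finset.univ.erase i,
            ‖(Circle.exp ((![(Q (T a)) 0, (Q (T a)) 1, -((Q (T a)) 0 + (Q (T a)) 1)] : Fin 3 → ℝ) i) : ℂ) -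
              (Circle.exp ((![(Q (T a)) 0, (Q (T a)) 1, -((Q (T a)) 0 + (Q (T a)) 1)] : Fin 3 → ℝ) k) : ℂ)‖) /
                (Fintype.card (Fin 3)).factorial) =
        (ENNReal.ofReal |(-2 * Real.sqrt 3 * (T (χ a)) 1) * (π / 3 * (π / (Real.sqrt 3 * Real.cos (π / 3 * (χ a) 0 - π / 6))))| *
            Jχ a /
          ENNReal.ofReal |(-2 * Real.sqrt 3 * (T a) 1) * (π / 3 * (π / (Real.sqrt 3 * Real.cos (π / 3 * a 0 - π / 6))))|) *
          ENNReal.ofReal ((∏ i, ∏ k ∈ Finset.univ.erase i,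
            ‖(Circle.exp ((![(Q (T (χ a))) 0, (Q (T (χ a))) 1, -((Q (T (χ a))) 0 + (Q (T (χ a))) 1)] : Fin 3 → ℝ) i) : ℂ) -
              (Circle.exp ((![(Q (T (χ a))) 0, (Q (T (χ a))) 1, -((Q (T (χ a))) 0 + (Q (T (χ a))) 1)] :
                Fin 3 → ℝ) k) : ℂ)‖) / (Fintype.card (Fin 3)).factorial) := by
    intro a ha
    rw [hJD'reg _ (hinjB a ha)]
    exact hJchart a ha
  have key : HasJacobian (haarProbability (Matrix.specialUnitaryGroup (Fin 3) ℂ)) h' J' :=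
    hasJacobian_spectralKernel_su3_booked_polarBoxFlow hT hQ hf'm (perm_wallId hf'reg hf'wall hfperm) hχ hχbox hfG'
      (hagree_wallId hf'reg hf'wall hagree hh'reg hh'wall) (norm_wallId hf'reg hf'wall hf1)
      (prod_wallId hf'reg hf'wall hfdet) hJD'm (perm_wallId_datum hJD'reg hJD'wall hJDperm) hJchart'
      (spec_wallId_datum hJD'reg hJD'wall hJspec hJ'reg hJ'wall)
  -- back to the shipped `h`, `J`: they agree with the primed ones off the (Haar-null) walls
  exact key.congr_ae_map (ae_eq_of_eqOn_separable fun W hW => (hh'reg W hW).symm)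
    (ae_eq_of_eqOn_separable fun W hW => (hJ'reg W hW).symm) hhm hJm

/-- **The `SU(3)` spectral coupling layer AS SHIPPED is an exact transport of `⊗ Haar_{SU(3)}` with
the booked `coupleJac`.**  Finite link set `ι`, mask `p`; per active link `a` and frozen links `y`: a
staple `S a y` (measurable in `y`), a box flow `χ a y` with `HasJacobian (Leb|_B)` and `χ a y (B) ⊆ B`,
the shipped eigenvalue map `f a y`, kernel `h a y`, spectral datum `JD a y` and density `j a y ≥ 0`
with the hypotheses of `hasJacobian_spectralKernel_su3_polar_shipped` (all algebraic ones at simple spectra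
only), kernel and density JOINTLY MEASURABLE in `(y, loop)`.  Then
`HasJacobian (⊗ Haar) (coupleFun p (u ↦ h a y (uS)(uS)⁻¹u)) (ofReal ∘ coupleJac p (j at the loops))`. -/
theorem hasJacobian_spectralCouplingLayer_su3_polar_shipped {ι : Type*} [Fintype ι]
    (p : ι → Prop) [DecidablePred p]
    (S : {i // p i} → ({i // ¬p i} → Matrix.specialUnitaryGroup (Fin 3) ℂ) → Matrix.specialUnitaryGroup (Fin 3) ℂ)
    (hS : ∀ a, Measurable (S a))
    (f : {i // p i} → ({i // ¬p i} → Matrix.specialUnitaryGroup (Fin 3) ℂ) → (Fin 3 → ℂ) → (Fin 3 → ℂ))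
    (hfm : ∀ a y, Measurable (f a y))
    (hfperm : ∀ a y (σ : Equiv.Perm (Fin 3)) (d : Fin 3 → ℂ), (∀ i, ‖d i‖ = 1) → Function.Injective d →
      f a y (fun i => d (σ i)) = fun i => f a y d (σ i))
    (χ : {i // p i} → ({i // ¬p i} → Matrix.specialUnitaryGroup (Fin 3) ℂ) → (Fin 2 → ℝ) → (Fin 2 → ℝ))
    (Jχ : {i // p i} → ({i // ¬p i} → Matrix.specialUnitaryGroup (Fin 3) ℂ) → (Fin 2 → ℝ) → ℝ≥0∞)
    (hχ : ∀ a y, HasJacobian (volume.restrict (Set.pi univ fun _ : Fin 2 => Ioo (0 : ℝ) 1)) (χ a y) (Jχ a y))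
    (hχbox : ∀ a y, ∀ b ∈ Set.pi univ (fun _ : Fin 2 => Ioo (0 : ℝ) 1),
      χ a y b ∈ Set.pi univ fun _ : Fin 2 => Ioo (0 : ℝ) 1)
    (hfG : ∀ a y, ∀ b ∈ Set.pi univ (fun _ : Fin 2 => Ioo (0 : ℝ) 1),
      f a y (fun i => (Circle.exp ((![(Q (T b)) 0, (Q (T b)) 1, -((Q (T b)) 0 + (Q (T b)) 1)] : Fin 3 → ℝ) i) : ℂ)) =
        fun i => (Circle.exp ((![(Q (T (χ a y b))) 0, (Q (T (χ a y b))) 1,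
          -((Q (T (χ a y b))) 0 + (Q (T (χ a y b))) 1)] : Fin 3 → ℝ) i) : ℂ))
    (h : {i // p i} → ({i // ¬p i} → Matrix.specialUnitaryGroup (Fin 3) ℂ) →
      Matrix.specialUnitaryGroup (Fin 3) ℂ → Matrix.specialUnitaryGroup (Fin 3) ℂ)
    (hhm : ∀ a, Measurable fun q : ({i // ¬p i} → Matrix.specialUnitaryGroup (Fin 3) ℂ) ×
      Matrix.specialUnitaryGroup (Fin 3) ℂ => h a q.1 q.2)
    (hagree : ∀ a y (Q : Matrix.specialUnitaryGroup (Fin 3) ℂ) (V : Matrix (Fin 3) (Fin 3) ℂ) (d : Fin 3 → ℂ),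
      V ∈ Matrix.unitaryGroup (Fin 3) ℂ → Function.Injective d →
        (Q : Matrix (Fin 3) (Fin 3) ℂ) = V * diagonal d * star V →
        ((h a y Q : Matrix.specialUnitaryGroup (Fin 3) ℂ) : Matrix (Fin 3) (Fin 3) ℂ) = V * diagonal (f a y d) * star V)
    (hf1 : ∀ a y (d : Fin 3 → ℂ), (∀ i, ‖d i‖ = 1) → Function.Injective d → ∀ i, ‖f a y d i‖ = 1)
    (hfdet : ∀ a y (d : Fin 3 → ℂ), (∀ i, ‖d i‖ = 1) → Function.Injective d → ∏ i, d i = 1 → ∏ i, f a y d i = 1)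
    (JD : {i // p i} → ({i // ¬p i} → Matrix.specialUnitaryGroup (Fin 3) ℂ) → (Fin 3 → ℂ) → ℝ≥0∞)
    (hJDm : ∀ a y, Measurable (JD a y))
    (hJDperm : ∀ a y (σ : Equiv.Perm (Fin 3)) (d : Fin 3 → ℂ), Function.Injective d →
      JD a y (fun i => d (σ i)) = JD a y d)
    (hJchart : ∀ a y, ∀ b ∈ Set.pi univ (fun _ : Fin 2 => Ioo (0 : ℝ) 1),
      JD a y (fun i => (Circle.exp ((![(Q (T b)) 0, (Q (T b)) 1, -((Q (T b)) 0 + (Q (T b)) 1)] : Fin 3 → ℝ) i) : ℂ)) *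
          ENNReal.ofReal ((∏ i, ∏ k ∈ Finset.univ.erase i,
            ‖(Circle.exp ((![(Q (T b)) 0, (Q (T b)) 1, -((Q (T b)) 0 + (Q (T b)) 1)] : Fin 3 → ℝ) i) : ℂ) -
              (Circle.exp ((![(Q (T b)) 0, (Q (T b)) 1, -((Q (T b)) 0 + (Q (T b)) 1)] : Fin 3 → ℝ) k) : ℂ)‖) /
                (Fintype.card (Fin 3)).factorial) =
        (ENNReal.ofReal |(-2 * Real.sqrt 3 * (T (χ a y b)) 1) * (π / 3 * (π / (Real.sqrt 3 * Real.cos (π / 3 * (χ a y b) 0 - π / 6))))| *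
            Jχ a y b /
          ENNReal.ofReal |(-2 * Real.sqrt 3 * (T b) 1) * (π / 3 * (π / (Real.sqrt 3 * Real.cos (π / 3 * b 0 - π / 6))))|) *
          ENNReal.ofReal ((∏ i, ∏ k ∈ Finset.univ.erase i,
            ‖(Circle.exp ((![(Q (T (χ a y b))) 0, (Q (T (χ a y b))) 1,
              -((Q (T (χ a y b))) 0 + (Q (T (χ a y b))) 1)] : Fin 3 → ℝ) i) : ℂ) -
              (Circle.exp ((![(Q (T (χ a y b))) 0, (Q (T (χ a y b))) 1,
                -((Q (T (χ a y b))) 0 + (Q (T (χ a y b))) 1)] : Fin 3 → ℝ) k) : ℂ)‖) / (Fintype.card (Fin 3)).factorial))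
    (j : {i // p i} → ({i // ¬p i} → Matrix.specialUnitaryGroup (Fin 3) ℂ) → Matrix.specialUnitaryGroup (Fin 3) ℂ → ℝ)
    (hj0 : ∀ a y g, 0 ≤ j a y g)
    (hjm : ∀ a, Measurable fun q : ({i // ¬p i} → Matrix.specialUnitaryGroup (Fin 3) ℂ) ×
      Matrix.specialUnitaryGroup (Fin 3) ℂ => j a q.1 q.2)
    (hJspec : ∀ a y (W : Matrix.specialUnitaryGroup (Fin 3) ℂ) (V : Matrix (Fin 3) (Fin 3) ℂ) (d : Fin 3 → ℂ),
      V ∈ Matrix.unitaryGroup (Fin 3) ℂ → Function.Injective d →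
        (W : Matrix (Fin 3) (Fin 3) ℂ) = V * diagonal d * star V → ENNReal.ofReal (j a y W) = JD a y d) :
    HasJacobian (Measure.pi fun _ : ι => haarProbability (Matrix.specialUnitaryGroup (Fin 3) ℂ))
      (Theory2.coupleFun p fun a y u => h a y (u * S a y) * (u * S a y)⁻¹ * u)
      fun U => ENNReal.ofReal (Theory2.coupleJac p (fun a y u => j a y (u * S a y)) U) := by
  haveI : SecondCountableTopology (Matrix (Fin 3) (Fin 3) ℂ) :=
    inferInstanceAs (SecondCountableTopology (Fin 3 → Fin 3 → ℂ))
  haveI : SecondCountableTopology (Matrix.specialUnitaryGroup (Fin 3) ℂ) :=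
    Topology.IsEmbedding.subtypeVal.secondCountableTopology
  have hloop : ∀ a, Measurable fun q : Matrix.specialUnitaryGroup (Fin 3) ℂ ×
      ({i // ¬p i} → Matrix.specialUnitaryGroup (Fin 3) ℂ) => q.1 * S a q.2 := fun a =>
    measurable_fst.mul ((hS a).comp measurable_snd)
  have hhy : ∀ a y, Measurable (h a y) := fun a y => (hhm a).comp (measurable_const.prodMk measurable_id)
  have hjy : ∀ a y, Measurable fun g => ENNReal.ofReal (j a y g) := fun a y =>
    ENNReal.measurable_ofReal.comp ((hjm a).comp (measurable_const.prodMk measurable_id))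
  refine hasJacobian_kernelCouplingLayer p S h j (fun a => ?_) (fun a => ?_) (fun a y => ?_) hj0
  · exact (((hhm a).comp (measurable_snd.prodMk (hloop a))).mul (hloop a).inv).mul measurable_fst
  · exact (hjm a).comp (measurable_snd.prodMk (hloop a))
  · exact hasJacobian_spectralKernel_su3_polar_shipped hT hQ (hfm a y) (hfperm a y) (hχ a y) (hχbox a y) (hfG a y)
      (hhy a y) (hagree a y) (hf1 a y) (hfdet a y) (hJDm a y) (hJDperm a y) (hJchart a y) (hjy a y) (hJspec a y)

end Shipped

end Summit.Ventures.LatticeQCDFlow.Exactness
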